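import Summits.QuantumFields.YangMills.Theorems.BalabanUVNodesK0Stub1FlatHessianLandauCoercivityAtRecord
import Summits.QuantumFields.YangMills.Theorems.BalabanUVNodesK0Stub1H128OfRecordCriticality
import HarnessLib

/-!
# N07 [B11], S1↔S4a: **AT THE FLAT BACKGROUND, S1's HESSIAN OPERATOR OF RECORD `Δ_1 = Node00.hessOpAt η 1` IS lit-balaban's CURL–CURL LETTER
# `∂*∂ = dcsE c ∘ dcE c` (read on matrix fields by p595460's kernel formula) UP TO THE DISPLAYED FACTOR `(N·c²)⁻¹`** — so the K0 socket `h127rec`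
# of `…K0Stub1H128OfRecordCriticality.exists_correctedCurrent_of_slice_lieSU` can be fed by a producer carrying EITHER Hessian letter

Cell `pub-ymgap` (HUMAN RULING D-0062 ∕ D-0149), Track A node N07 = [Balaban1985Variational]; width seat `pub-ymgap-dag-n07-w1` (g6), lane S1∕D4.
Trigger: k0-s1-w1 g5 HANDOFF § g5 (t1) «if [the socket's `Δ(1)`] is S1's `hessOpAt η 1`: ONE adapter (p593232 §1: hessOpAt entrywise = `LatticeFieldCalculus` curl
form; prove `Σ Re tr((∂μ)ᴴ hessOpAt A) = 0` and `= (dcsE∘dcE)_V` pairing on tests) then the same».  `--kind proof --supports stmt-QuantumFields-26907 --as helper`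
(K1⁸ per KEY MAP v1.65; count-neutral).  [15] = [Balaban1985Variational]; [5] = [Balaban1985BackgroundPropagators]; [B5] = [Balaban1984PropagatorsI];
[B6] = [Balaban1984PropagatorsII].

WHY.  The (Q2) chain of the K0 road (dag-n07-e `K0-ROAD-CHAIN-CHECKLIST.md` §6) ends in k0-s1-w1's junction `exists_correctedCurrent_of_slice_lieSU` (p620347), whose ONE
displayed input is the SOCKET `h127rec`: the record's criticality in chart coordinates, `Σ_b Re tr(δ_bᴴ((K_V A′)_b + Wf_b)) = 0` for every 𝔰𝔲(N)-valued test `δ`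
in the record's multi-level kernel, with the Hessian letter `K_V` = the kernel-formula extension of lit-balaban's `dcsE c ∘ dcE c` ([B6] (2.5), (2.19)).  A producer
working from NODE 00's objects (the (26) expansion `…N07SectBExpansionAtObjects.wilsonAction4_expChart_expansion_hessOpAt`, [15] (26) ∕ [5] (3.10)) carries instead
S1's `Δ_1 = hessOpAt η 1` on the carrier `TangentBondSU P 0 N`.  This file proves the two letters agree up to `(N·c²)⁻¹` — as pairings (§3), POINTWISE (§4) — and
turns one socket shape into the other (§6); §5 is (hK) for S1's letter (pure gauges pair to zero against `Δ_1A`).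

WHAT IS PROVED (sorry-free; no definition; axioms standard; `M = M_N(ℂ)`; `⇑X` = the matrix field `b ↦ (X b : M)` of `X ∈ TangentBondSU P j N`).
* §1 ★ `inner_hessOpAt_one_eq_sum_curl` — POLARISATION of p593232 §1: `⟪X, Δ_1Y⟫ = N⁻¹·Σ_{p : Plaq} Re tr((curl 1 ⇑X)(p)ᴴ (curl 1 ⇑Y)(p))` (any level `j`, `η ≠ 0`).
* §2 ★ `pairing_curlCurlExt_eq_sum_curl` — for `K_V` with the kernel formula of `dcsE c ∘ dcE c` and ANY matrix fields `δ, A` on `PBond P 0`: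
  `Σ_b Re tr(δ_bᴴ (K_V A)_b) = Σ_p Re tr((curl c δ)(p)ᴴ (curl c A)(p))` (entrywise readings, `⟪x, ∂*∂y⟫ = ⟪∂x, ∂y⟫`).
* §3 ★★ `pairing_hessOpAt_one_eq` — for `δ, A ∈ TangentBondSU P 0 N`, `c ≠ 0`: `Σ_b Re tr((δ b)ᴴ ((Δ_1A) b)) = (N·c²)⁻¹ · Σ_b Re tr((δ b)ᴴ (K_V ⇑A)_b)`.
* §4 ★★ `curlCurlExt_mem_lieSU`, `coe_hessOpAt_one_apply` — POINTWISE: `((Δ_1A) b : M) = (N·c²)⁻¹ • (K_V ⇑A) b` (S1's (R3) «no pointwise formula claimed» holds at a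
  general background; at `U₀ = 1` the curl–curl letter preserves 𝔰𝔲(N)-valuedness and the Riesz representative IS it, rescaled).
* §5 `inner_hessOpAt_one_pureGauge_eq_zero` — (hK) for S1's letter: a tangent vector reading `b ↦ μ(b₊) − μ(b₋)` pairs to `0` against `Δ_1A` (`curl ∘ grad = 0`).
* §6 ★★★ `socket_curlCurlExt_iff_socket_hessOpAt` — for `A′ ∈ TangentBondSU P 0 N`, any current `Wf`, any nested family `D`:
  «`∀ δ : PBond → 𝔰𝔲(N)`, (`D.LamBond j e → dIterL j 1 ⇑δ e = 0`) `→ Σ_b Re tr(δ_bᴴ((K_V ⇑A′)_b + (N·c²)•Wf_b)) = 0`»  ↔  «same tests `→ Σ_b Re tr(δ_bᴴ(((Δ_1A′) b : M) + Wf_b)) = 0`»;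
  the left member is VERBATIM the `h127rec` binder of `exists_correctedCurrent_of_slice_lieSU` (current `(N·c²)•Wf`); ★★★ `socket_curlCurlExt_iff_socket_hessOpAt_inner`
  — the same with the right member in S1's own currency (`δ ∈ TangentBondSU P 0 N`, `⟪δ, Δ_1A′⟫ + Σ_b Re tr((δ b)ᴴ Wf_b) = 0`).
HONEST SCOPE.  Finite-dimensional bookkeeping (polarisation + entrywise real readings) over kernel-checked identities of S1 (`Node00/HessianOperatorAtBackground`),
p593232, p620347, p608822 and lit-balaban's V1 operators, all BY NAME; NO estimate; the SOCKET itself (the record's criticality in chart coordinates) is NOT produced here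
(S2∕S4b), `‖Rᵀ‖` is NOT bounded; nothing of Bałaban's analysis asserted; `stub_prop8StepCoP13` ∕ K0⁷ ∕ K1⁸ NOT closed; N07 NOT discharged; counts unmoved
(28∕28 · 5∕27); one finite 𝕋⁴ programme at fixed ε — R4 closes the conditional finite-𝕋⁴ rung `BalabanLadder.UV` only, never the summit; the YM mass gap (Clay) is NOT
proved by any of this; nothing continuum ∕ ℝ⁴ ∕ OS.  No `sorry`, no `def`, no `instance`, no `notation`.

References: [5] (3.4), (3.10)–(3.11) pp.391–392; [15] (26) p.282, (127)–(128) p.297, (153) p.301, (158) p.302; [B5] (1.2)–(1.4) p.18; [B6] (2.5)–(2.7) p.224, (2.19)–(2.20) p.226.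
-/

set_option autoImplicit false
noncomputable section
open scoped BigOperators Matrix InnerProductSpace RealInnerProductSpace

namespace Summit.QuantumFields.YangMills.BalabanUVNodes.N07FlatHessianCurlCurlAdapter

open Literature.MathematicalPhysics.QuantumFieldTheory.Balaban1983to89
open Literature.MathematicalPhysics.QuantumFieldTheory.Balaban1983to89.Node00
open Literature.MathematicalPhysics.QuantumFieldTheory.BalabanImbrieJaffe1984to88.BIJ85AxialPropagator411 (BondSpace PlaqSpace)
open T4AdjointCovarianceUnitary (lieSU mem_lieSU_iff)
open LatticeFieldCalculus (curl grad)
open B6SectADomainsV1 (Domains)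
open B6SectAOperatorsV1 (dcE dcsE inner_dcsE_left inner_eq_sum)
open Summit.QuantumFields.YangMills.Theorems.K0Stub1FlatHessianLandauCoercivity (inner_hessOpAt_one_self_eq_sum_curl_normSq
  curl_entry_re curl_entry_im)
open Summit.QuantumFields.YangMills.Theorems.K0Stub1H128OfRecordCriticality (pairing_eq_sum_entries exists_entryCLM)
open Summit.QuantumFields.YangMills.Theorems.K0Stub1CurlCurlRowOfEq158 (toLp_re_reading_extension)

variable {P : Params} {N : ℕ} {j : ℕ}

/-! ## §1  Polarisation: the flat Hessian form of record off the diagonal -/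

/-- The curl pairing `Σ_p Re tr((curl c A)(p)ᴴ (curl c B)(p))` is additive in its second slot. [cite: Balaban1984PropagatorsI, (1.2) p.18] -/
theorem sum_curl_pairing_add_right (c : ℝ) (A B C : VecField P j (Matrix (Fin N) (Fin N) ℂ)) :
    ∑ p : Plaq P j, ((curl c A p)ᴴ * curl c (fun b => B b + C b) p).trace.re =
      ∑ p : Plaq P j, ((curl c A p)ᴴ * curl c B p).trace.re + ∑ p : Plaq P j, ((curl c A p)ᴴ * curl c C p).trace.re := by
  rw [← Finset.sum_add_distrib]
  refine Finset.sum_congr rfl fun p _ => ?_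
  rw [LatticeFieldCalculus.curl_add, Matrix.mul_add, Matrix.trace_add, Complex.add_re]

/-- The curl pairing is symmetric (`Re tr(BᴴA) = Re tr(AᴴB)`). [cite: Balaban1985BackgroundPropagators, p.392] -/
theorem sum_curl_pairing_comm (c : ℝ) (A B : VecField P j (Matrix (Fin N) (Fin N) ℂ)) :
    ∑ p : Plaq P j, ((curl c A p)ᴴ * curl c B p).trace.re = ∑ p : Plaq P j, ((curl c B p)ᴴ * curl c A p).trace.re := by
  refine Finset.sum_congr rfl fun p _ => ?_
  rw [show (curl c B p)ᴴ * curl c A p = ((curl c A p)ᴴ * curl c B p)ᴴ by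
      rw [Matrix.conjTranspose_mul, Matrix.conjTranspose_conjTranspose], Matrix.trace_conjTranspose]
  exact (Complex.conj_re _).symm

variable [NeZero N]

/-- ★ **POLARISATION of p593232 §1** ([5] (3.10) at `U ≡ 1`, «the operator `∂*∂` in the Abelian case», read entrywise): for all `X, Y` of S1's carrier,
`⟪X, Δ_1Y⟫ = N⁻¹ · Σ_{p : Plaq} Re tr((curl 1 ⇑X)(p)ᴴ (curl 1 ⇑Y)(p))` — both sides are symmetric bilinear forms with the same diagonal
(`inner_hessOpAt_one_self_eq_sum_curl_normSq`, `Re tr(MᴴM) = Σ|M_{ii′}|²`). [cite: Balaban1985BackgroundPropagators, (3.10) p.392, (3.4) p.391; Balaban1984PropagatorsI, (1.2) p.18] -/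
theorem inner_hessOpAt_one_eq_sum_curl {η : ℝ} (hη : η ≠ 0) (X Y : TangentBondSU P j N) :
    ⟪X, hessOpAt η (1 : GaugeField P j (SU N)) Y⟫_ℝ =
      (N : ℝ)⁻¹ * ∑ p : Plaq P j, ((curl 1 (fun b => ((X b : lieSU (Fin N)) : Matrix (Fin N) (Fin N) ℂ)) p)ᴴ *
        curl 1 (fun b => ((Y b : lieSU (Fin N)) : Matrix (Fin N) (Fin N) ℂ)) p).trace.re := by
  -- the two quadratic forms
  set T := hessOpAt η (1 : GaugeField P j (SU N)) with hT
  let R : TangentBondSU P j N → TangentBondSU P j N → ℝ := fun X Y =>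
    (N : ℝ)⁻¹ * ∑ p : Plaq P j, ((curl 1 (fun b => ((X b : lieSU (Fin N)) : Matrix (Fin N) (Fin N) ℂ)) p)ᴴ *
      curl 1 (fun b => ((Y b : lieSU (Fin N)) : Matrix (Fin N) (Fin N) ℂ)) p).trace.re
  -- diagonal agreement (p593232 §1)
  have hdiag : ∀ Z : TangentBondSU P j N, ⟪Z, T Z⟫_ℝ = R Z Z := by
    intro Z
    rw [hT, inner_hessOpAt_one_self_eq_sum_curl_normSq hη]
    congr 1
    refine Finset.sum_congr rfl fun p _ => ?_
    rw [MatrixNorms.sum_norm_sq_eq_re_trace]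
  -- symmetry and additivity of both forms
  have hBsymm : ∀ X Y : TangentBondSU P j N, ⟪Y, T X⟫_ℝ = ⟪X, T Y⟫_ℝ := fun X Y => by
    rw [← hessOpAt_isSymmetric η (1 : GaugeField P j (SU N)) X Y, real_inner_comm]
  have hRsymm : ∀ X Y : TangentBondSU P j N, R Y X = R X Y := fun X Y => by
    simp only [R]; rw [sum_curl_pairing_comm]
  have hcoe : ∀ X Y : TangentBondSU P j N,
      (fun b => (((X + Y) b : lieSU (Fin N)) : Matrix (Fin N) (Fin N) ℂ)) =
        fun b => ((X b : lieSU (Fin N)) : Matrix (Fin N) (Fin N) ℂ) + ((Y b : lieSU (Fin N)) : Matrix (Fin N) (Fin N) ℂ) := by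
    intro X Y; funext b; rw [PiLp.add_apply, Submodule.coe_add]
  have hRadd : ∀ X Y Z : TangentBondSU P j N, R X (Y + Z) = R X Y + R X Z := fun X Y Z => by
    simp only [R]; rw [hcoe, sum_curl_pairing_add_right, mul_add]
  have hBadd : ∀ X Y Z : TangentBondSU P j N, ⟪X, T (Y + Z)⟫_ℝ = ⟪X, T Y⟫_ℝ + ⟪X, T Z⟫_ℝ := fun X Y Z => by
    rw [map_add, inner_add_right]
  -- expand the diagonal at `X + Y`
  have hB2 : ⟪X + Y, T (X + Y)⟫_ℝ = ⟪X, T X⟫_ℝ + 2 * ⟪X, T Y⟫_ℝ + ⟪Y, T Y⟫_ℝ := by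
    rw [inner_add_left, hBadd, hBadd, hBsymm X Y]; ring
  have hR2 : R (X + Y) (X + Y) = R X X + 2 * R X Y + R Y Y := by
    rw [hRadd, ← hRsymm (X + Y) X, ← hRsymm (X + Y) Y, hRadd, hRadd, hRsymm X Y]; ring
  have h := hdiag (X + Y)
  rw [hB2, hR2, hdiag X, hdiag Y] at h
  show ⟪X, T Y⟫_ℝ = R X Y
  linarith

/-! ## §2  The curl–curl kernel extension in the pairing -/

omit [NeZero N] in
/-- `Im z = Re((−I)·z)`. [folklore] -/
private theorem im_eq_re_neg_I_mul (z : ℂ) : z.im = (-Complex.I * z).re := by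
  simp [Complex.mul_re]

omit [NeZero N] in
/-- ★ **THE CURL–CURL EXTENSION IN THE FROBENIUS PAIRING**: for `K_V` with p595460's kernel formula of `∂*∂ = dcsE c ∘ dcE c` and ANY matrix fields `δ, A`:
`Σ_b Re tr(δ_bᴴ (K_V A)_b) = Σ_{p : Plaq} Re tr((curl c δ)(p)ᴴ (curl c A)(p))` — entry by entry `⟪x, ∂*∂y⟫ = ⟪∂x, ∂y⟫` ([B6] (2.19), the first square).
[cite: Balaban1984PropagatorsII, (2.5) p.224, (2.19) p.226; Balaban1984PropagatorsI, (1.2) p.18] -/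
theorem pairing_curlCurlExt_eq_sum_curl {instDE : DecidableEq (PBond P 0)} (c : ℝ)
    {KV : (PBond P 0 → Matrix (Fin N) (Fin N) ℂ) →ₗ[ℂ] (PBond P 0 → Matrix (Fin N) (Fin N) ℂ)}
    (hKV : ∀ (A : PBond P 0 → Matrix (Fin N) (Fin N) ℂ) (b : PBond P 0),
      KV A b = ∑ j, ((WithLp.ofLp ((dcsE c ∘ₗ dcE c) (WithLp.toLp 2 (Pi.single j 1))) b : ℝ) : ℂ) • A j)
    (δ A : PBond P 0 → Matrix (Fin N) (Fin N) ℂ) :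
    ∑ b, ((δ b)ᴴ * KV A b).trace.re = ∑ p : Plaq P 0, ((curl c δ p)ᴴ * curl c A p).trace.re := by
  rw [pairing_eq_sum_entries, pairing_eq_sum_entries]
  refine Finset.sum_congr rfl fun j _ => Finset.sum_congr rfl fun i _ => ?_
  obtain ⟨φ, hφ⟩ := exists_entryCLM (N := N) j i
  have hψ : ∀ X : Matrix (Fin N) (Fin N) ℂ, ((-Complex.I) • φ) X = -Complex.I * X j i := fun X => by
    show -Complex.I • φ X = _; rw [hφ, smul_eq_mul]
  -- real and imaginary parts of the curl–curl letter
  have hre : WithLp.toLp 2 (fun b => (KV A b j i).re) = (dcsE c ∘ₗ dcE c) (WithLp.toLp 2 (fun b => (A b j i).re)) := by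
    simpa only [hφ] using toLp_re_reading_extension (dcsE c ∘ₗ dcE c) (A := A) (𝔄 := KV A) (fun b => hKV A b) φ
  have him : WithLp.toLp 2 (fun b => (KV A b j i).im) = (dcsE c ∘ₗ dcE c) (WithLp.toLp 2 (fun b => (A b j i).im)) := by
    simpa only [hψ, ← im_eq_re_neg_I_mul] using
      toLp_re_reading_extension (dcsE c ∘ₗ dcE c) (A := A) (𝔄 := KV A) (fun b => hKV A b) ((-Complex.I) • φ)
  -- `⟪x, ∂*∂y⟫ = ⟪∂x, ∂y⟫ = Σ_p (curl c x)(p) (curl c y)(p)`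
  have key : ∀ x y : BondSpace P, ⟪x, (dcsE c ∘ₗ dcE c) y⟫_ℝ = ∑ p : Plaq P 0, curl c (WithLp.ofLp x) p * curl c (WithLp.ofLp y) p := by
    intro x y
    rw [LinearMap.comp_apply, ← real_inner_comm x (dcsE c (dcE c y)), inner_dcsE_left, real_inner_comm (dcE c x) (dcE c y),
      inner_eq_sum]
    rfl
  -- the entrywise curls
  have hcre : ∀ (B : PBond P 0 → Matrix (Fin N) (Fin N) ℂ) (p : Plaq P 0),
      curl c (WithLp.ofLp (WithLp.toLp 2 (fun b => (B b j i).re))) p = (curl c B p j i).re := fun B p => by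
    rw [WithLp.ofLp_toLp, curl_entry_re]
  have hcim : ∀ (B : PBond P 0 → Matrix (Fin N) (Fin N) ℂ) (p : Plaq P 0),
      curl c (WithLp.ofLp (WithLp.toLp 2 (fun b => (B b j i).im))) p = (curl c B p j i).im := fun B p => by
    rw [WithLp.ofLp_toLp, curl_entry_im]
  rw [hre, him, key, key]
  simp only [hcre, hcim, inner_eq_sum, ← Finset.sum_add_distrib]

/-! ## §3  S1's letter against the curl–curl letter: the factor `(N·c²)⁻¹` -/

omit [NeZero N] in
/-- Scaling of the plaquette variable in the lattice factor: `curl c A = c • curl 1 A`. [cite: Balaban1984PropagatorsI, (1.2) p.18] -/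
theorem curl_eq_smul_curl_one (c : ℝ) (A : VecField P j (Matrix (Fin N) (Fin N) ℂ)) (p : Plaq P j) :
    curl c A p = c • curl 1 A p := by
  simp only [LatticeFieldCalculus.curl, one_smul]

omit [NeZero N] in
/-- The curl pairing in the factor `c` is `c²` times the pairing in the factor `1`. [cite: Balaban1984PropagatorsI, (1.2) p.18] -/
theorem sum_curl_pairing_eq_sq_mul (c : ℝ) (A B : VecField P j (Matrix (Fin N) (Fin N) ℂ)) :
    ∑ p : Plaq P j, ((curl c A p)ᴴ * curl c B p).trace.re = c ^ 2 * ∑ p : Plaq P j, ((curl 1 A p)ᴴ * curl 1 B p).trace.re := by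
  rw [Finset.mul_sum]
  refine Finset.sum_congr rfl fun p _ => ?_
  rw [curl_eq_smul_curl_one c A, curl_eq_smul_curl_one c B, Matrix.conjTranspose_smul, star_trivial, Matrix.smul_mul,
    Matrix.mul_smul, smul_smul, Matrix.trace_smul, Complex.real_smul, Complex.re_ofReal_mul, sq]

omit [NeZero N] in
/-- The Frobenius pairing of two tangent vectors, written on their matrix fields, is the carrier's inner product (S1 `inner_tangentBondSU`).
[cite: Balaban1985Averaging, (17) p.21] -/
theorem sum_re_trace_eq_inner (X Y : TangentBondSU P j N) :
    ∑ b, ((((X b : lieSU (Fin N)) : Matrix (Fin N) (Fin N) ℂ))ᴴ * ((Y b : lieSU (Fin N)) : Matrix (Fin N) (Fin N) ℂ)).trace.re = ⟪X, Y⟫_ℝ := by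
  rw [inner_tangentBondSU]

/-- ★★ **S1's `Δ_1` AGAINST lit-balaban's `∂*∂` ON 𝔰𝔲(N)-VALUED TESTS**: for `δ, A ∈ TangentBondSU P 0 N`, `η ≠ 0`, `c ≠ 0`, and `K_V` with the kernel formula of
`dcsE c ∘ dcE c`: `Σ_b Re tr((δ b)ᴴ ((Δ_1A) b)) = (N·c²)⁻¹ · Σ_b Re tr((δ b)ᴴ (K_V ⇑A)_b)`.  (S1's carrier pairing is the UNNORMALISED Hilbert–Schmidt one while the
form (3.10) carries `τ_N = N⁻¹tr`, whence `N⁻¹`; lit-balaban's `∂` carries the lattice factor `c`, whence `c⁻²`.)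
[cite: Balaban1985BackgroundPropagators, (3.10)-(3.11) p.392; Balaban1984PropagatorsII, (2.5) p.224, (2.19) p.226] -/
theorem pairing_hessOpAt_one_eq {instDE : DecidableEq (PBond P 0)} {η : ℝ} (hη : η ≠ 0) {c : ℝ} (hc : c ≠ 0)
    {KV : (PBond P 0 → Matrix (Fin N) (Fin N) ℂ) →ₗ[ℂ] (PBond P 0 → Matrix (Fin N) (Fin N) ℂ)}
    (hKV : ∀ (A : PBond P 0 → Matrix (Fin N) (Fin N) ℂ) (b : PBond P 0),
      KV A b = ∑ j, ((WithLp.ofLp ((dcsE c ∘ₗ dcE c) (WithLp.toLp 2 (Pi.single j 1))) b : ℝ) : ℂ) • A j)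
    (δ A : TangentBondSU P 0 N) :
    ∑ b, ((((δ b : lieSU (Fin N)) : Matrix (Fin N) (Fin N) ℂ))ᴴ *
        ((hessOpAt η (1 : GaugeField P 0 (SU N)) A b : lieSU (Fin N)) : Matrix (Fin N) (Fin N) ℂ)).trace.re =
      ((N : ℝ) * c ^ 2)⁻¹ * ∑ b, ((((δ b : lieSU (Fin N)) : Matrix (Fin N) (Fin N) ℂ))ᴴ *
        KV (fun b => ((A b : lieSU (Fin N)) : Matrix (Fin N) (Fin N) ℂ)) b).trace.re := by
  rw [sum_re_trace_eq_inner, inner_hessOpAt_one_eq_sum_curl hη, pairing_curlCurlExt_eq_sum_curl c hKV, sum_curl_pairing_eq_sq_mul c,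
    mul_inv, mul_assoc, inv_mul_cancel_left₀ (pow_ne_zero 2 hc)]

/-! ## §4  Pointwise: the Riesz representative at the flat background IS the rescaled curl–curl letter -/

omit [NeZero N] in
/-- The curl–curl extension of an 𝔰𝔲(N)-valued field is 𝔰𝔲(N)-valued (a REAL combination of the values: the kernel is real). [cite: Balaban1984PropagatorsII, (2.5) p.224] -/
theorem curlCurlExt_mem_lieSU {instDE : DecidableEq (PBond P 0)} (c : ℝ)
    {KV : (PBond P 0 → Matrix (Fin N) (Fin N) ℂ) →ₗ[ℂ] (PBond P 0 → Matrix (Fin N) (Fin N) ℂ)}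
    (hKV : ∀ (A : PBond P 0 → Matrix (Fin N) (Fin N) ℂ) (b : PBond P 0),
      KV A b = ∑ j, ((WithLp.ofLp ((dcsE c ∘ₗ dcE c) (WithLp.toLp 2 (Pi.single j 1))) b : ℝ) : ℂ) • A j)
    {A : PBond P 0 → Matrix (Fin N) (Fin N) ℂ} (hA : ∀ b, A b ∈ lieSU (Fin N)) (b : PBond P 0) : KV A b ∈ lieSU (Fin N) := by
  rw [hKV]
  refine Submodule.sum_mem _ fun j _ => ?_
  rw [Complex.coe_smul]
  exact Submodule.smul_mem _ _ (hA j)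

/-- ★★ **POINTWISE FORMULA AT THE FLAT BACKGROUND**: `((Δ_1A) b : M_N(ℂ)) = (N·c²)⁻¹ • (K_V ⇑A)_b` for every `A ∈ TangentBondSU P 0 N` and bond `b` — S1's Riesz
representative of the form (3.10) at `U₀ = 1` is lit-balaban's `∂*∂` read on matrix fields, rescaled (both are 𝔰𝔲(N)-valued and have the same pairings against
every 𝔰𝔲(N)-valued test, §3). [cite: Balaban1985BackgroundPropagators, (3.10) p.392; Balaban1984PropagatorsII, (2.5) p.224, (2.19) p.226] -/
theorem coe_hessOpAt_one_apply {instDE : DecidableEq (PBond P 0)} {η : ℝ} (hη : η ≠ 0) {c : ℝ} (hc : c ≠ 0)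
    {KV : (PBond P 0 → Matrix (Fin N) (Fin N) ℂ) →ₗ[ℂ] (PBond P 0 → Matrix (Fin N) (Fin N) ℂ)}
    (hKV : ∀ (A : PBond P 0 → Matrix (Fin N) (Fin N) ℂ) (b : PBond P 0),
      KV A b = ∑ j, ((WithLp.ofLp ((dcsE c ∘ₗ dcE c) (WithLp.toLp 2 (Pi.single j 1))) b : ℝ) : ℂ) • A j)
    (A : TangentBondSU P 0 N) (b : PBond P 0) :
    ((hessOpAt η (1 : GaugeField P 0 (SU N)) A b : lieSU (Fin N)) : Matrix (Fin N) (Fin N) ℂ) =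
      ((N : ℝ) * c ^ 2)⁻¹ • KV (fun b => ((A b : lieSU (Fin N)) : Matrix (Fin N) (Fin N) ℂ)) b := by
  -- the rescaled curl–curl letter as a tangent vector
  have hmem : ∀ b, ((N : ℝ) * c ^ 2)⁻¹ • KV (fun b => ((A b : lieSU (Fin N)) : Matrix (Fin N) (Fin N) ℂ)) b ∈ lieSU (Fin N) := fun b =>
    Submodule.smul_mem _ _ (curlCurlExt_mem_lieSU c hKV (fun b => (A b).2) b)
  let Y : TangentBondSU P 0 N := WithLp.toLp 2 fun b => ⟨_, hmem b⟩
  have hY : ∀ b, ((Y b : lieSU (Fin N)) : Matrix (Fin N) (Fin N) ℂ) = ((N : ℝ) * c ^ 2)⁻¹ • KV (fun b => ((A b : lieSU (Fin N)) : Matrix (Fin N) (Fin N) ℂ)) b :=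
    fun b => rfl
  suffices h : hessOpAt η (1 : GaugeField P 0 (SU N)) A = Y by rw [h, hY]
  refine ext_inner_left ℝ fun δ => ?_
  rw [← sum_re_trace_eq_inner, ← sum_re_trace_eq_inner, pairing_hessOpAt_one_eq hη hc hKV, Finset.mul_sum]
  refine Finset.sum_congr rfl fun b _ => ?_
  rw [hY, Matrix.mul_smul, Matrix.trace_smul, Complex.real_smul, Complex.re_ofReal_mul]

/-! ## §5  (hK) for S1's letter: pure gauges pair to zero against `Δ_1A` -/

/-- **(hK) for `Δ_1`**: if the matrix field of a tangent vector `G` is a plain pure gauge `b ↦ μ(b₊) − μ(b₋)` (`μ` any matrix-valued site function), then `⟪G, Δ_1A⟫ = 0` for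
every `A` — `curl ∘ grad = 0` inside §1's curl form. [cite: Balaban1984PropagatorsI, (1.2)-(1.4) p.18; Balaban1985BackgroundPropagators, (3.10) p.392] -/
theorem inner_hessOpAt_one_pureGauge_eq_zero {η : ℝ} (hη : η ≠ 0) (G A : TangentBondSU P j N) (μ : Site P j → Matrix (Fin N) (Fin N) ℂ)
    (hG : ∀ b, ((G b : lieSU (Fin N)) : Matrix (Fin N) (Fin N) ℂ) = μ b.tgt - μ b.src) :
    ⟪G, hessOpAt η (1 : GaugeField P j (SU N)) A⟫_ℝ = 0 := by
  rw [inner_hessOpAt_one_eq_sum_curl hη]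
  refine mul_eq_zero_of_right _ (Finset.sum_eq_zero fun p _ => ?_)
  have hgrad : (fun b => ((G b : lieSU (Fin N)) : Matrix (Fin N) (Fin N) ℂ)) = grad 1 μ := by
    funext b; rw [hG, LatticeFieldCalculus.grad, one_smul]
  rw [hgrad, LatticeFieldCalculus.curl_grad, Matrix.conjTranspose_zero, Matrix.zero_mul, Matrix.trace_zero, Complex.zero_re]

/-! ## §6  The two socket shapes -/

omit [NeZero N] in
/-- The Frobenius pairing is additive in the second slot. [folklore] -/
theorem sum_re_trace_mul_add {ι : Type*} [Fintype ι] (δ Y Z : ι → Matrix (Fin N) (Fin N) ℂ) :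
    ∑ b, ((δ b)ᴴ * (Y b + Z b)).trace.re = ∑ b, ((δ b)ᴴ * Y b).trace.re + ∑ b, ((δ b)ᴴ * Z b).trace.re := by
  rw [← Finset.sum_add_distrib]
  refine Finset.sum_congr rfl fun b _ => ?_
  rw [Matrix.mul_add, Matrix.trace_add, Complex.add_re]

omit [NeZero N] in
/-- The Frobenius pairing against a real multiple. [folklore] -/
theorem sum_re_trace_mul_smul {ι : Type*} [Fintype ι] (r : ℝ) (δ Z : ι → Matrix (Fin N) (Fin N) ℂ) :
    ∑ b, ((δ b)ᴴ * (r • Z b)).trace.re = r * ∑ b, ((δ b)ᴴ * Z b).trace.re := by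
  rw [Finset.mul_sum]
  refine Finset.sum_congr rfl fun b _ => ?_
  rw [Matrix.mul_smul, Matrix.trace_smul, Complex.real_smul, Complex.re_ofReal_mul]

/-- ★★★ **THE TWO SOCKET SHAPES ARE EQUIVALENT.**  For `A′ ∈ TangentBondSU P 0 N` (S1's carrier), any current `Wf`, any nested family `D`, `η ≠ 0`, `c ≠ 0`, and `K_V` with
the kernel formula of `dcsE c ∘ dcE c`:  the `h127rec` binder of k0-s1-w1's `exists_correctedCurrent_of_slice_lieSU` with Hessian letter `K_V` and current `(N·c²)•Wf` —
«every 𝔰𝔲(N)-valued test `δ` in the record's multi-level kernel (`Q_j(1)δ = 0` on every `Λ_j`-bond) has `Σ_b Re tr(δ_bᴴ((K_V ⇑A′)_b + (N·c²)•Wf_b)) = 0`» — HOLDS IFF the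
same tests annihilate `((Δ_1A′) b : M) + Wf_b`, the shape an S1∕(26)-based producer of the record's criticality in chart coordinates delivers.
[cite: Balaban1985Variational, (127)-(128) p.297, (26) p.282; Balaban1985BackgroundPropagators, (3.10) p.392; Balaban1984PropagatorsII, (2.19) p.226] -/
theorem socket_curlCurlExt_iff_socket_hessOpAt {instDE : DecidableEq (PBond P 0)} (D : Domains P) {η : ℝ} (hη : η ≠ 0) {c : ℝ} (hc : c ≠ 0)
    {KV : (PBond P 0 → Matrix (Fin N) (Fin N) ℂ) →ₗ[ℂ] (PBond P 0 → Matrix (Fin N) (Fin N) ℂ)}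
    (hKV : ∀ (A : PBond P 0 → Matrix (Fin N) (Fin N) ℂ) (b : PBond P 0),
      KV A b = ∑ j, ((WithLp.ofLp ((dcsE c ∘ₗ dcE c) (WithLp.toLp 2 (Pi.single j 1))) b : ℝ) : ℂ) • A j)
    (A' : TangentBondSU P 0 N) (Wf : PBond P 0 → Matrix (Fin N) (Fin N) ℂ) :
    (∀ δ : PBond P 0 → lieSU (Fin N),
        (∀ (j : ℕ) (e : PBond P j), D.LamBond j e →
          dIterL j (1 : PBond P 0 → Matrix (Fin N) (Fin N) ℂ) (fun b => (δ b : Matrix (Fin N) (Fin N) ℂ)) e = 0) →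
        ∑ b, (((δ b : Matrix (Fin N) (Fin N) ℂ))ᴴ *
          (KV (fun b => ((A' b : lieSU (Fin N)) : Matrix (Fin N) (Fin N) ℂ)) b + ((N : ℝ) * c ^ 2) • Wf b)).trace.re = 0) ↔
      ∀ δ : PBond P 0 → lieSU (Fin N),
        (∀ (j : ℕ) (e : PBond P j), D.LamBond j e →
          dIterL j (1 : PBond P 0 → Matrix (Fin N) (Fin N) ℂ) (fun b => (δ b : Matrix (Fin N) (Fin N) ℂ)) e = 0) →
        ∑ b, (((δ b : Matrix (Fin N) (Fin N) ℂ))ᴴ *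
          (((hessOpAt η (1 : GaugeField P 0 (SU N)) A' b : lieSU (Fin N)) : Matrix (Fin N) (Fin N) ℂ) + Wf b)).trace.re = 0 := by
  have hNc : (N : ℝ) * c ^ 2 ≠ 0 := mul_ne_zero (Nat.cast_ne_zero.mpr (NeZero.ne N)) (pow_ne_zero 2 hc)
  -- the two pairings differ by the factor `N·c²`, test by test
  have key : ∀ δ : PBond P 0 → lieSU (Fin N),
      ∑ b, (((δ b : Matrix (Fin N) (Fin N) ℂ))ᴴ *
          (KV (fun b => ((A' b : lieSU (Fin N)) : Matrix (Fin N) (Fin N) ℂ)) b + ((N : ℝ) * c ^ 2) • Wf b)).trace.re =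
        ((N : ℝ) * c ^ 2) * ∑ b, (((δ b : Matrix (Fin N) (Fin N) ℂ))ᴴ *
          (((hessOpAt η (1 : GaugeField P 0 (SU N)) A' b : lieSU (Fin N)) : Matrix (Fin N) (Fin N) ℂ) + Wf b)).trace.re := by
    intro δ
    have h3 := pairing_hessOpAt_one_eq hη hc hKV (WithLp.toLp 2 δ) A'
    rw [sum_re_trace_mul_add, sum_re_trace_mul_add, sum_re_trace_mul_smul, mul_add, h3, mul_inv_cancel_left₀ hNc]
  refine ⟨fun h δ hδ => ?_, fun h δ hδ => ?_⟩
  · have := h δ hδ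
    rw [key] at this
    exact (mul_eq_zero.mp this).resolve_left hNc
  · rw [key, h δ hδ, mul_zero]

/-- ★★★ The same equivalence with the right member in S1's OWN currency — tests `δ ∈ TangentBondSU P 0 N` and the carrier's inner product:
«`∀ δ`, (`D.LamBond j e → dIterL j 1 ⇑δ e = 0`) `→ ⟪δ, Δ_1A′⟫ + Σ_b Re tr((δ b)ᴴ Wf_b) = 0`» (the shape read off the (26) expansion
`…N07SectBExpansionAtObjects.wilsonAction4_expChart_expansion_hessOpAt`: `𝔄(U₀·exp X) = 𝔄(U₀) + ⟨A_X, J⟩ + ½⟪X, Δ_{U₀}X⟫ + rem₃`).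
[cite: Balaban1985Variational, (26) p.282, (127)-(128) p.297; Balaban1985BackgroundPropagators, (3.10) p.392; Balaban1984PropagatorsII, (2.19) p.226] -/
theorem socket_curlCurlExt_iff_socket_hessOpAt_inner {instDE : DecidableEq (PBond P 0)} (D : Domains P) {η : ℝ} (hη : η ≠ 0) {c : ℝ} (hc : c ≠ 0)
    {KV : (PBond P 0 → Matrix (Fin N) (Fin N) ℂ) →ₗ[ℂ] (PBond P 0 → Matrix (Fin N) (Fin N) ℂ)}
    (hKV : ∀ (A : PBond P 0 → Matrix (Fin N) (Fin N) ℂ) (b : PBond P 0),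
      KV A b = ∑ j, ((WithLp.ofLp ((dcsE c ∘ₗ dcE c) (WithLp.toLp 2 (Pi.single j 1))) b : ℝ) : ℂ) • A j)
    (A' : TangentBondSU P 0 N) (Wf : PBond P 0 → Matrix (Fin N) (Fin N) ℂ) :
    (∀ δ : PBond P 0 → lieSU (Fin N),
        (∀ (j : ℕ) (e : PBond P j), D.LamBond j e →
          dIterL j (1 : PBond P 0 → Matrix (Fin N) (Fin N) ℂ) (fun b => (δ b : Matrix (Fin N) (Fin N) ℂ)) e = 0) →
        ∑ b, (((δ b : Matrix (Fin N) (Fin N) ℂ))ᴴ *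
          (KV (fun b => ((A' b : lieSU (Fin N)) : Matrix (Fin N) (Fin N) ℂ)) b + ((N : ℝ) * c ^ 2) • Wf b)).trace.re = 0) ↔
      ∀ δ : TangentBondSU P 0 N,
        (∀ (j : ℕ) (e : PBond P j), D.LamBond j e →
          dIterL j (1 : PBond P 0 → Matrix (Fin N) (Fin N) ℂ) (fun b => ((δ b : lieSU (Fin N)) : Matrix (Fin N) (Fin N) ℂ)) e = 0) →
        ⟪δ, hessOpAt η (1 : GaugeField P 0 (SU N)) A'⟫_ℝ +
          ∑ b, ((((δ b : lieSU (Fin N)) : Matrix (Fin N) (Fin N) ℂ))ᴴ * Wf b).trace.re = 0 := by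
  rw [socket_curlCurlExt_iff_socket_hessOpAt D hη hc hKV A' Wf]
  refine ⟨fun h δ hδ => ?_, fun h δ hδ => ?_⟩
  · rw [← sum_re_trace_eq_inner, ← sum_re_trace_mul_add]
    exact h (WithLp.ofLp δ) hδ
  · rw [sum_re_trace_mul_add]
    have h' := h (WithLp.toLp 2 δ) hδ
    rw [← sum_re_trace_eq_inner] at h'
    exact h'

end Summit.QuantumFields.YangMills.BalabanUVNodes.N07FlatHessianCurlCurlAdapter
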